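import Summits.ABC.IUTFork.Joshi.LogLinkColumnModel
import Summits.ABC.IUTFork.Joshi.LogLinkInsertedIso
import HarnessLib

/-!
# A kernel MODEL in which BOTH horns of the [J-IIp] Thm. 10.15.1 (3) reading fork occur in ONE structure — the (R-fix) horn
# (print's `τ(1) = p` route, p430819 `noInsertedIso_of_logsCoincide`) is NON-VACUOUS over the period-ring signature, and sits
# exactly where §10.13's Frobenius transport fails — VACUITY CHECK, nothing more

Test-side support file of the abc-iut cell, branch E (rung LADDER-ABC:A2.E; seat abc-iut-E-t52, booked role «[J-IIp] §10 horns NV»;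
gen-2 companion to this seat's `Joshi/LogLinkColumnModel.lean` p434703). Hypotheses instantiated: K. Joshi, arXiv:2303.01662v3 §10
(bib `Joshi2023ATS2Local`, unrefereed — TYPED AS A CANDIDATE by abc-iut-E-t3 / E-t7 in `Joshi/LogLinkColumn.lean` p429867,
`Joshi/LogLinkFrobeniusTransport.lean` p430819, `Joshi/LogLinkInsertedIso.lean` p436476). TAKES NO SIDE on [IUTchIII] Cor. 3.12, on
Joshi's claims, or on Mochizuki's reports on them; a model EXHIBITS joint satisfiability of TYPED hypotheses, nothing more; typed ≠
proved ≠ endorsed. Object-side (E-PLAN R14: no `Cor312*`/`Thm311*` import); no FACT-LIST row consumed; nothing asserted.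

THE QUESTION. p430819 located a reading fork in the proof of Thm. 10.15.1 (3) (p.33 l.66–77): in reading (R-ϕ) (`FrobCompatible`)
the typed (3) FAILS and (4) HOLDS; in reading (R-fix) (`LogsCoincide`: the two logarithms `B^{φ=p} → ℂ_p` literally coincide)
print's `τ(1) = p·1` argument proves (3) (`noInsertedIso_of_logsCoincide`, given «log hits `1`», `p ≠ 1`). p434703 gave the (R-ϕ)
horn a non-degenerate model; p436476 (E-t7) showed that WHEREVER §10.13's transport exists, (3) fails for EVERY identification and
(R-fix) + «log hits `1`» + `p ≠ 1` is contradictory. Left open: is the (R-fix) hypothesis set — `LogsCoincide I ∧ (∃ b ∈ B^{φ=p},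
η_{ϕ(y)} b = 1) ∧ (p : C) ≠ 1` with the WHOLE period-ring signature and `KummerShift` — satisfiable AT ALL (refuters' vacuity smell,
CONVENTIONS §4)? By p436476 a witness can only sit at a point WITHOUT transport.

THE MODEL `confluentDatum p` (§3) = E-t3's `Model.periodRingDatum p` (`B := (Q̄_p → Q̄_p)`, `η_y` = evaluation, `φ(y) = y^p` on
points) with two fields changed, as in p434703: `φ(b) := b ∘ σ′` and `T_y :=` the `φ`-eigenfunctions vanishing on `y, y^p, y^{p²}, …`.
The column is p434703's two-sided FROBENIUS ORBIT `c_{n+1} = c_n^p`, `c_0 = p^{p+1}` (`ColumnModel.col`, BY NAME); the shift is now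
CONFLUENT (§1): `σ′(c_n) = c_{n−1}` for `n ≠ 1` but `σ′(c_1) := c_{−1} = σ′(c_0)`, identity off the column. So `B^{φ=p}` contains `g`
(§2: `g(c_n) = p^{−n}` for `n ≤ 0`, `p^{1−n}` for `n ≥ 1`, `0` off the column) with `g(c_0) = g(c_1) = 1`, and EVERY `b ∈ B^{φ=p}` has
`b(c_0) = b(c_1)`. RESULTS: §4 `KummerShift` HOLDS, `T_{y_p} ∋ g ≠ 0` at the Ansatz base point `y_p = p`. §5 AT `y₀ = c_0` (an
Ansatz-type point, `col_zero_ansatz`): §10.13's transport DOES NOT EXIST (`no_transport_zero`; blame exhibited by `exists_ker_witness`: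
«`ϕ(𝔪_{y_{n−1}}) = 𝔪_{y_n}`», p.33 l.5, fails there), (R-fix) HOLDS for the identity identifications (`logsCoincide_zero`), the
logarithm hits `1` at both ends, `p ≠ 1`; HENCE Thm. 10.15.1 (3) HOLDS in BOTH typed forms — common-target form by p430819's
`noInsertedIso_of_logsCoincide` (print's argument, now about a NONEMPTY class: `noInsertedIso_zero`) and E-t3's middle-row form
(`noCommutingFieldIso_zero`, via §0) — and (4) HOLDS by surjectivity of the logarithm (`logShellStep_zero`). §6 AT EVERY `c_n`,
`n ≠ 0` (in particular `y₁ = c_1 = ϕ(y₀)`): transport EXISTS, the identity identifications are `FrobCompatible`, log hits `1`; so (3)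
FAILS in both forms, (4) HOLDS, (R-fix) FAILS for every identification — p434703's (R-ϕ) horn, unchanged. §7 packages both over `Q̄_2`
(`both_horns_one_structure`). ONE-LINE RESULT: in ONE structure satisfying the whole signature with `KummerShift`, two CONSECUTIVE
points `y₀`, `y₁ = ϕ(y₀)` of a Frobenius column realise the two horns, separated by exactly one datum — §10.13 at the point; so
p430819's positive half is not vacuous, and what it costs is §10.13 there (p436476), nothing else the signature records. §0: under
(R-fix) + «log hits `1`» + `p ≠ 1`, E-t3's `NoCommutingFieldIso y` HOLDS (dual to p430819's `not_noCommutingFieldIso_of_transport`)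
and `FrobeniusTransport y` is EMPTY (p436476 repackaged). [folklore] model-building; no claim about Joshi's or Mochizuki's
mathematics; continuity is modelled nowhere in this signature (p430819/p436476/p437232 docstrings).
-/

noncomputable section

open Set

namespace Summit.ABC.IUTFork.Joshi

/-! ## 0. Over the signature: two duals of the transport lemmas, in reading (R-fix) -/

namespace PeriodRingDatum

variable {F B E0 : Type} [Field F] [CommRing B] [Field E0] {Y : Type} {K : Y → Type} [∀ y, Field (K y)] {G : Type}
  {D : PeriodRingDatum F B E0 Y K G} {C : Type} [Field C]

/-- Under (R-fix), a `b ∈ B^{φ=p}` whose logarithm at `ϕ(y)` is `1` has logarithm `1` at `y` too (`iso₀ (η_y b) = iso₁ 1 = 1`).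
[claim: Joshi2023ATS2Local, status: disputed] -/
theorem eta_eq_one_of_logsCoincide {y : Y} (I : D.CommonTarget C y) (hfix : LogsCoincide I) {b : B} (hb : b ∈ D.Bphi)
    (hb1 : D.eta (D.frobY y) b = 1) : D.eta y b = 1 := by
  have h := hfix b hb
  simp only [CommonTarget.log₀, CommonTarget.log₁, hb1, map_one] at h
  exact I.iso₀.injective (h.trans (map_one I.iso₀).symm)

/-- **Under (R-fix) + «the logarithm of `ϕ(y)` hits `1`» + `p ≠ 1` in `C`, E-t3's AS-PRINTED middle-row form of Thm. 10.15.1 (3)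
(`NoCommutingFieldIso y`, p429867) HOLDS** — dual to p430819's `not_noCommutingFieldIso_of_transport`: a commuting `f : K_y ≃ K_{ϕ(y)}`
must send `η_y b = 1` to `p · η_{ϕ(y)} b = p` (`commuting_iso_apply`), so `p = 1` in `K_{ϕ(y)} ≃ C`. Print's `τ(1) = p` argument
(p.33 l.75–77), middle-row version. [claim: Joshi2023ATS2Local, status: disputed] -/
theorem noCommutingFieldIso_of_logsCoincide {y : Y} (I : D.CommonTarget C y) (hfix : LogsCoincide I)
    (hone : ∃ b ∈ D.Bphi, D.eta (D.frobY y) b = 1) (hp : (D.p : C) ≠ 1) : D.NoCommutingFieldIso y := by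
  rintro ⟨f, hf⟩
  obtain ⟨b, hb, hb1⟩ := hone
  have h := D.commuting_iso_apply f hf hb
  rw [eta_eq_one_of_logsCoincide I hfix hb hb1, hb1, map_one, mul_one] at h
  exact hp (by rw [← map_natCast I.iso₁ D.p, ← h, map_one])

/-- **Under (R-fix) + «log hits `1`» + `p ≠ 1`, §10.13's transport structure at `y` is EMPTY** (p436476 repackaged): one of
«`ϕ` a ring map», «`η_y`, `η_{ϕ(y)} ∘ ϕ` onto», «`ϕ(𝔪_y) = 𝔪_{ϕ(y)}`» fails at such a point. [claim: Joshi2023ATS2Local, status: disputed] -/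
theorem isEmpty_transport_of_logsCoincide {y : Y} (I : D.CommonTarget C y) (hfix : LogsCoincide I)
    (hone : ∃ b ∈ D.Bphi, D.eta (D.frobY y) b = 1) (hp : (D.p : C) ≠ 1) : IsEmpty (D.FrobeniusTransport y) :=
  ⟨fun T => logsCoincide_absurd_of_transport T I hfix hone hp⟩

end PeriodRingDatum

namespace ConfluentModel

open PadicAlgCl ColumnModel

variable (p : ℕ) [hp : Fact p.Prime]

/-- `(p : Q̄_p) ≠ 0`. [folklore] -/
private theorem natCast_p_ne_zero : (p : PadicAlgCl p) ≠ 0 := by exact_mod_cast hp.out.ne_zero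
/-- `(p : Q̄_p) ≠ 1`. [folklore] -/
private theorem natCast_p_ne_one : (p : PadicAlgCl p) ≠ 1 := by exact_mod_cast hp.out.ne_one
/-- `c_n ≠ c_1` for `n ≠ 1` (p434703 `col_injective`). [folklore] -/
private theorem col_ne_col_one {n : ℤ} (hn : n ≠ 1) : col p n ≠ col p 1 := fun h => hn (col_injective p h)

/-! ## 1–2. The confluent shift `σ′`, the eigenfunction `g` and the eigenline -/

open Classical in
/-- **The confluent shift** `σ′`: p434703's shift `σ` (`σ(c_n) = c_{n−1}`, identity off the column) except at ONE point,
`σ′(c_1) := c_{−1}` (`= σ′(c_0)`). [folklore] -/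
def cshift (s : PadicAlgCl p) : PadicAlgCl p := if s = col p 1 then col p (-1) else shift p s

/-- `σ′(c_1) = c_{−1}`. [folklore] -/
theorem cshift_col_one : cshift p (col p 1) = col p (-1) := by unfold cshift; rw [if_pos rfl]
/-- `σ′(c_n) = c_{n−1}` for `n ≠ 1`. [folklore] -/
theorem cshift_col {n : ℤ} (hn : n ≠ 1) : cshift p (col p n) = col p (n - 1) := by
  unfold cshift; rw [if_neg (col_ne_col_one p hn), shift_col]

/-- `σ′(c_0) = c_{−1}` — the confluence `σ′(c_0) = σ′(c_1)`. [folklore] -/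
theorem cshift_col_zero : cshift p (col p 0) = col p (-1) := by rw [cshift_col p zero_ne_one, zero_sub]
/-- `σ′` fixes every point off the column. [folklore] -/
theorem cshift_of_not_col {s : PadicAlgCl p} (hs : ∀ n : ℤ, col p n ≠ s) : cshift p s = s := by
  unfold cshift; rw [if_neg (fun h => hs 1 h.symm), shift_of_not_col p hs]

/-- `σ′(p) = p` (the base point of E-t3's norm is off the column, p434703 `p_ne_col`). [folklore] -/
theorem cshift_p : cshift p (p : PadicAlgCl p) = p := cshift_of_not_col p fun n h => p_ne_col p n h.symm

/-- **Away from the confluence the shift inverts Frobenius**: `σ′(c_n^p) = σ′(c_{n+1}) = c_n` for `n ≠ 0` — §10.13's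
«`ϕ(𝔪_{y_{n−1}}) = 𝔪_{y_n}`» in the model, at those points. [folklore] -/
theorem cshift_col_pow {n : ℤ} (hn : n ≠ 0) : cshift p (col p n ^ p) = col p n := by
  rw [← col_succ, cshift_col p (fun h => hn (by omega)), add_sub_cancel_right]

/-- **At the confluence it does not**: `σ′(c_0^p) = σ′(c_1) = c_{−1} ≠ c_0`. [folklore] -/
theorem cshift_col_zero_pow : cshift p (col p 0 ^ p) = col p (-1) := by rw [← col_succ, zero_add, cshift_col_one]

/-- The exponent profile of `g`: `−n` for `n ≤ 0`, `1 − n` for `n ≥ 1` (so the values at `n = 0` and `n = 1` agree). [folklore] -/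
def cexp (n : ℤ) : ℤ := if 1 ≤ n then 1 - n else -n

/-- `cexp (n − 1) = cexp n + 1` for `n ≠ 1`. [folklore] -/
theorem cexp_sub_one {n : ℤ} (hn : n ≠ 1) : cexp (n - 1) = cexp n + 1 := by unfold cexp; split_ifs <;> omega

/-- `cexp 0 = 0 = cexp 1` (the coincidence) and `cexp (−1) = 1`. [folklore] -/
theorem cexp_vals : cexp 0 = 0 ∧ cexp 1 = 0 ∧ cexp (-1) = 1 := by unfold cexp; refine ⟨?_, ?_, ?_⟩ <;> split_ifs <;> omega

open Classical in
/-- **The eigenfunction** `g`: `p^{cexp n}` at `c_n`, `0` off the column. [folklore] -/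
def cgen (s : PadicAlgCl p) : PadicAlgCl p := if h : ∃ n : ℤ, col p n = s then (p : PadicAlgCl p) ^ cexp h.choose else 0

/-- `g(c_n) = p^{cexp n}`. [folklore] -/
theorem cgen_col (n : ℤ) : cgen p (col p n) = (p : PadicAlgCl p) ^ cexp n := by
  have h : ∃ k : ℤ, col p k = col p n := ⟨n, rfl⟩
  unfold cgen; rw [dif_pos h, col_injective p h.choose_spec]

/-- `g = 0` off the column. [folklore] -/
theorem cgen_of_not_col {s : PadicAlgCl p} (hs : ∀ n : ℤ, col p n ≠ s) : cgen p s = 0 := by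
  unfold cgen; rw [dif_neg (not_exists.2 hs)]

/-- `g(c_0) = 1`. [folklore] -/
theorem cgen_col_zero : cgen p (col p 0) = 1 := by rw [cgen_col, cexp_vals.1, zpow_zero]
/-- `g(c_1) = 1` — the logarithm of `g` is `1` at BOTH ends of the log-link `c_0 ↦ c_1`. [folklore] -/
theorem cgen_col_one : cgen p (col p 1) = 1 := by rw [cgen_col, cexp_vals.2.1, zpow_zero]

/-- `g ≠ 0`. [folklore] -/
theorem cgen_ne_zero : cgen p ≠ 0 := fun h => by
  have := congrFun h (col p 0); rw [cgen_col_zero] at this; exact one_ne_zero this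

/-- **The eigen-relation** `g(σ′ s) = p · g(s)` for every `s` (at the confluence: `g(c_{−1}) = p = p · g(c_1)`). [folklore] -/
theorem cgen_cshift (s : PadicAlgCl p) : cgen p (cshift p s) = (p : PadicAlgCl p) * cgen p s := by
  by_cases h : ∃ n : ℤ, col p n = s
  · obtain ⟨n, rfl⟩ := h
    by_cases hn : n = 1
    · subst hn; rw [cshift_col_one, cgen_col, cgen_col, cexp_vals.2.2, cexp_vals.2.1, zpow_one, zpow_zero, mul_one]
    · rw [cshift_col p hn, cgen_col, cgen_col, cexp_sub_one hn, zpow_add_one₀ (natCast_p_ne_zero p), mul_comm]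
  · have hs : ∀ n : ℤ, col p n ≠ s := not_exists.1 h
    rw [cshift_of_not_col p hs, cgen_of_not_col p hs, mul_zero]

open Classical in
/-- The indicator of the point `c_0` (the witness that §10.13 fails at `c_0`). [folklore] -/
def ind0 (s : PadicAlgCl p) : PadicAlgCl p := if s = col p 0 then 1 else 0

/-- `ind0 (c_0) = 1`. [folklore] -/
theorem ind0_col_zero : ind0 p (col p 0) = 1 := by unfold ind0; rw [if_pos rfl]
/-- `ind0 (c_{−1}) = 0`. [folklore] -/
theorem ind0_col_neg_one : ind0 p (col p (-1)) = 0 := by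
  unfold ind0; rw [if_neg (fun h => absurd (col_injective p h) (by decide))]

/-! ## 3. The model datum -/

/-- **The confluent column model** of the period-ring signature: E-t3's `Model.periodRingDatum p` with `φ(b) := b ∘ σ′` and
`T_y := {τ | τ ∘ σ′ = p·τ pointwise ∧ τ vanishes on y, y^p, y^{p²}, …}`; every other field is E-t3's, unchanged (cf. p434703
`ColumnModel.columnDatum`, which has `σ` in place of `σ′`). [folklore] -/
def confluentDatum : PeriodRingDatum (PadicAlgCl p) (PadicAlgCl p → PadicAlgCl p) (PadicAlgCl p) (PadicAlgCl p)
    (fun _ => PadicAlgCl p) Unit :=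
  { Model.periodRingDatum p with
    frob := fun b => b ∘ cshift p
    frob_norm_one := fun b hb => by
      show ‖(b ∘ cshift p) (p : PadicAlgCl p)‖ ≤ 1
      rw [Function.comp_apply, cshift_p]; exact hb
    T := fun y => {τ | (∀ s, τ (cshift p s) = (p : PadicAlgCl p) * τ s) ∧ ∀ m : ℕ, τ (y ^ p ^ m) = 0}
    zero_mem_T := fun y => ⟨fun s => by simp, fun m => rfl⟩
    eta_T := fun y τ hτ => by
      show τ y = 0
      have := hτ.2 0; rwa [pow_zero, pow_one] at this
    T_norm_one := fun y τ hτ => by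
      show ‖τ (p : PadicAlgCl p)‖ ≤ 1
      have h := hτ.1 (p : PadicAlgCl p); rw [cshift_p] at h
      rw [(mul_left_eq_self₀.1 h.symm).resolve_left (natCast_p_ne_one p), norm_zero]; exact zero_le_one }

/-- Unfolding: `φ(b) = b ∘ σ′`. [folklore] -/
theorem frob_def (b : PadicAlgCl p → PadicAlgCl p) : (confluentDatum p).frob b = b ∘ cshift p := rfl
/-- Unfolding: `η_y(b) = b(y)`. [folklore] -/
theorem eta_def (y : PadicAlgCl p) (b : PadicAlgCl p → PadicAlgCl p) : (confluentDatum p).eta y b = b y := rfl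
/-- Unfolding: `φ(y) = y^p` on points. [folklore] -/
theorem frobY_def (y : PadicAlgCl p) : (confluentDatum p).frobY y = y ^ p := rfl
/-- Unfolding: the model's `p` is `p`. [folklore] -/
theorem p_def : (confluentDatum p).p = p := rfl

/-- `ϕ(c_0) = c_1`: the two points of §5–§6 are CONSECUTIVE on the Frobenius column. [folklore] -/
theorem frobY_col_zero : (confluentDatum p).frobY (col p 0) = col p 1 := by rw [frobY_def, ← col_succ, zero_add]

/-- `y₀ = c_0` is an Ansatz-type point: `c_0 = y_a` (`pt = id`) with `a = c_0 ≠ 0`, `|a|_F < 1`. [folklore] -/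
theorem col_zero_ansatz : (confluentDatum p).pt (col p 0) = col p 0 ∧ col p 0 ≠ 0 ∧ (confluentDatum p).absF (col p 0) < 1 := by
  refine ⟨rfl, fun h => ?_, show Model.absOne p (col p 0) < 1 from ?_⟩
  · have := (norm_colBase_pos_lt_one p).1; rw [← col_zero, h, norm_zero] at this; exact lt_irrefl _ this
  · rw [Model.absOne_apply, col_zero]; exact (norm_colBase_pos_lt_one p).2

/-- **Membership in `B^{φ=p}`** is the pointwise eigen-relation `b(σ′ s) = p·b(s)`. [folklore] -/
theorem mem_Bphi_iff (b : PadicAlgCl p → PadicAlgCl p) :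
    b ∈ (confluentDatum p).Bphi ↔ ∀ s, b (cshift p s) = (p : PadicAlgCl p) * b s := by
  show (b ∘ cshift p = ((p : ℕ) : PadicAlgCl p → PadicAlgCl p) * b) ↔ _
  constructor
  · intro h s; have := congrFun h s; simpa using this
  · intro h; funext s; simpa using h s

/-- Every multiple `c · g` lies in `B^{φ=p}`. [folklore] -/
theorem smul_cgen_mem_Bphi (c : PadicAlgCl p) : (fun s => c * cgen p s) ∈ (confluentDatum p).Bphi :=
  (mem_Bphi_iff p _).2 fun s => by rw [cgen_cshift]; ring

/-- `g ∈ B^{φ=p}`. [folklore] -/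
theorem cgen_mem_Bphi : cgen p ∈ (confluentDatum p).Bphi := by
  have := smul_cgen_mem_Bphi p 1; simpa only [one_mul] using this

/-- **The confluence seen by the logarithms**: every `b ∈ B^{φ=p}` takes the SAME value at `c_0` and at `c_1 = c_0^p`
(both are `p⁻¹ · b(c_{−1})`). [folklore] -/
theorem apply_col_zero_eq_apply_col_one {b : PadicAlgCl p → PadicAlgCl p} (hb : b ∈ (confluentDatum p).Bphi) :
    b (col p 0) = b (col p 1) := by
  rw [mem_Bphi_iff] at hb
  have h0 := hb (col p 0); have h1 := hb (col p 1)
  rw [cshift_col_zero] at h0; rw [cshift_col_one] at h1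
  exact mul_left_cancel₀ (natCast_p_ne_zero p) (h0.symm.trans h1)

/-- Membership in `T_y`, unfolded. [folklore] -/
theorem mem_T_iff (y : PadicAlgCl p) (τ : PadicAlgCl p → PadicAlgCl p) :
    τ ∈ (confluentDatum p).T y ↔ τ ∈ (confluentDatum p).Bphi ∧ ∀ m : ℕ, τ (y ^ p ^ m) = 0 := by
  rw [mem_Bphi_iff]; rfl

/-! ## 4. `KummerShift` holds, non-degenerately -/

/-- **E-t3's `KummerShift` (Thm. 10.20.1 (1)(2) reading: `T_y ⊆ B^{φ=p}`, `φ(T_y) ⊆ T_{φ(y)}`) HOLDS in the confluent model**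
(as in p434703: `φ τ = τ ∘ σ′` is again an eigenfunction and `τ(σ′(y^{p^{m+1}})) = p · 0`). [folklore] -/
theorem kummerShift : (confluentDatum p).KummerShift := by
  refine ⟨fun y τ hτ => ((mem_T_iff p y τ).1 hτ).1, fun y τ hτ => ?_⟩
  obtain ⟨h1, h2⟩ := (mem_T_iff p y τ).1 hτ
  rw [mem_Bphi_iff] at h1
  refine (mem_T_iff p _ _).2 ⟨(mem_Bphi_iff p _).2 fun s => ?_, fun m => ?_⟩
  · show τ (cshift p (cshift p s)) = (p : PadicAlgCl p) * τ (cshift p s)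
    exact h1 (cshift p s)
  · show τ (cshift p (((confluentDatum p).frobY y) ^ p ^ m)) = 0
    rw [frobY_def, ← pow_mul, ← pow_succ', h1, h2 (m + 1), mul_zero]

/-- **`T` is non-degenerate**: `T_{y_p} ∋ g ≠ 0` at the Ansatz base point `y_p = p` (its orbit `p^{p^m}` avoids the column,
p434703 `pow_p_ne_col`). [folklore] -/
theorem tateModule_nontrivial : ∃ τ ∈ (confluentDatum p).T (p : PadicAlgCl p), τ ≠ 0 :=
  ⟨cgen p, (mem_T_iff p _ _).2 ⟨cgen_mem_Bphi p, fun m => cgen_of_not_col p fun n h => pow_p_ne_col p m n h.symm⟩,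
    cgen_ne_zero p⟩

/-! ## 5. The (R-fix) horn at `y₀ = c_0`: no transport, coinciding logarithms, (3) in both forms, (4) -/

/-- The IDENTITY identifications `K_y = K_{ϕ(y)} = Q̄_p` as a common target (§10.14; cf. p434703 `ColumnModel.target`). [folklore] -/
def idTarget (y : PadicAlgCl p) : (confluentDatum p).CommonTarget (PadicAlgCl p) y where
  iso₀ := RingEquiv.refl _
  iso₁ := RingEquiv.refl _

/-- `p ≠ 1` in the common target. [folklore] -/
theorem modelP_ne_one : ((confluentDatum p).p : PadicAlgCl p) ≠ 1 := by rw [p_def]; exact natCast_p_ne_one p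

/-- **«The logarithm hits `1`» at every column point**: `p^{−cexp(n+1)} · g ∈ B^{φ=p}` has value `1` at `ϕ(c_n) = c_{n+1}`. [folklore] -/
theorem hone (n : ℤ) : ∃ b ∈ (confluentDatum p).Bphi, (confluentDatum p).eta ((confluentDatum p).frobY (col p n)) b = 1 :=
  ⟨fun s => ((p : PadicAlgCl p) ^ cexp (n + 1))⁻¹ * cgen p s, smul_cgen_mem_Bphi p _, by
    rw [eta_def, frobY_def, ← col_succ, cgen_col, inv_mul_cancel₀ (zpow_ne_zero _ (natCast_p_ne_zero p))]⟩

/-- **§10.13 FAILS at `c_0`, exhibited**: for the indicator `b` of `c_0`, `φ(b) = b ∘ σ′` lies in `𝔪_{ϕ(c_0)} = ker η_{c_1}`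
(`b(σ′(c_1)) = b(c_{−1}) = 0`) while `b ∉ 𝔪_{c_0}` (`b(c_0) = 1`): `ϕ^{-1}(𝔪_{ϕ(y₀)}) ≠ 𝔪_{y₀}`. [folklore] -/
theorem exists_ker_witness : ∃ b : PadicAlgCl p → PadicAlgCl p,
    (confluentDatum p).eta ((confluentDatum p).frobY (col p 0)) ((confluentDatum p).frob b) = 0 ∧
      (confluentDatum p).eta (col p 0) b ≠ 0 :=
  ⟨ind0 p, by rw [eta_def, frob_def, frobY_def, Function.comp_apply, cshift_col_zero_pow, ind0_col_neg_one],
    by rw [eta_def, ind0_col_zero]; exact one_ne_zero⟩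

/-- **NO §10.13 transport exists at `y₀ = c_0`** (p430819's HYPOTHESIS structure `FrobeniusTransport` is empty there: its
`ker_eq` is refuted by `exists_ker_witness`). [folklore] -/
theorem no_transport_zero : IsEmpty ((confluentDatum p).FrobeniusTransport (col p 0)) := by
  refine ⟨fun T => ?_⟩
  obtain ⟨b, hb0, hb1⟩ := exists_ker_witness p
  have h : b ∈ RingHom.ker (((confluentDatum p).eta ((confluentDatum p).frobY (col p 0))).comp T.frobHom) := by
    rw [RingHom.mem_ker, RingHom.comp_apply, T.frobHom_eq]; exact hb0
  rw [T.ker_eq, RingHom.mem_ker] at h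
  exact hb1 h

/-- **Reading (R-fix) HOLDS at `y₀ = c_0`** for the identity identifications: the two logarithms `B^{φ=p} → Q̄_p`, `b ↦ b(c_0)` and
`b ↦ b(c_1)`, are the same map (`apply_col_zero_eq_apply_col_one`). [folklore] -/
theorem logsCoincide_zero : PeriodRingDatum.LogsCoincide (idTarget p (col p 0)) := by
  intro b hb
  show (confluentDatum p).eta (col p 0) b = (confluentDatum p).eta ((confluentDatum p).frobY (col p 0)) b
  rw [eta_def, eta_def, frobY_col_zero]
  exact apply_col_zero_eq_apply_col_one p hb

/-- **Thm. 10.15.1 (3), common-target form, HOLDS at `y₀`** — by p430819's `noInsertedIso_of_logsCoincide` (print's `τ(1) = p·1`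
argument), now a statement about a NONEMPTY class of structures. [claim: Joshi2023ATS2Local, status: disputed] -/
theorem noInsertedIso_zero : PeriodRingDatum.NoInsertedIso (idTarget p (col p 0)) :=
  PeriodRingDatum.noInsertedIso_of_logsCoincide _ (logsCoincide_zero p) (hone p 0) (modelP_ne_one p)

/-- **Thm. 10.15.1 (3), E-t3's as-printed middle-row form, HOLDS at `y₀`** (§0 `noCommutingFieldIso_of_logsCoincide`).
[claim: Joshi2023ATS2Local, status: disputed] -/
theorem noCommutingFieldIso_zero : (confluentDatum p).NoCommutingFieldIso (col p 0) :=
  PeriodRingDatum.noCommutingFieldIso_of_logsCoincide _ (logsCoincide_zero p) (hone p 0) (modelP_ne_one p)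

/-- **Thm. 10.15.1 (4) HOLDS at `y₀`** — by surjectivity of the logarithm of `ϕ(y₀)` (`c · g ↦ c`; p430819
`logShellStep_of_log₁_surjective`: under (R-fix) (4) reads `L ⊆ p·L` for `L = Q̄_p`). [claim: Joshi2023ATS2Local, status: disputed] -/
theorem logShellStep_zero : PeriodRingDatum.LogShellStep (idTarget p (col p 0)) := by
  refine PeriodRingDatum.logShellStep_of_log₁_surjective _ (fun c => ⟨fun s => c * cgen p s, smul_cgen_mem_Bphi p c, ?_⟩) ?_
  · show (confluentDatum p).eta ((confluentDatum p).frobY (col p 0)) (fun s => c * cgen p s) = c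
    rw [eta_def, frobY_col_zero, cgen_col_one, mul_one]
  · rw [p_def]; exact natCast_p_ne_zero p

/-! ## 6. The (R-ϕ) horn at every other column point (p434703's horn, unchanged); both horns packaged -/

/-- **§10.13's transport at `c_n`, `n ≠ 0`**: `φ = (· ∘ σ′)` is a ring map, evaluations are onto, `σ′(c_n^p) = c_n`. [folklore] -/
def transport (n : ℤ) (hn : n ≠ 0) : (confluentDatum p).FrobeniusTransport (col p n) where
  frobHom := RingHom.pi fun s => Pi.evalRingHom (fun _ : PadicAlgCl p => PadicAlgCl p) (cshift p s)
  frobHom_eq _ := rfl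
  eta_surj k := ⟨fun _ => k, rfl⟩
  eta_frob_surj k := ⟨fun _ => k, rfl⟩
  ker_eq := by
    ext b
    simp only [RingHom.mem_ker, RingHom.coe_comp, Function.comp_apply]
    show b (cshift p (col p n ^ p)) = 0 ↔ b (col p n) = 0
    rw [cshift_col_pow p hn]

/-- **Reading (R-ϕ) HOLDS at `c_n`, `n ≠ 0`**: `σ_y` is the identity of `Q̄_p` through the identity identifications. [folklore] -/
theorem frobCompatible (n : ℤ) (hn : n ≠ 0) : PeriodRingDatum.FrobCompatible (transport p n hn) (idTarget p (col p n)) := by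
  intro k
  obtain ⟨b, rfl⟩ : ∃ b : PadicAlgCl p → PadicAlgCl p, (confluentDatum p).eta (col p n) b = k := ⟨fun _ => k, rfl⟩
  show (transport p n hn).residueIso ((confluentDatum p).eta (col p n) b) = (confluentDatum p).eta (col p n) b
  rw [(transport p n hn).residueIso_eta, eta_def, eta_def, frobY_def, frob_def, Function.comp_apply, cshift_col_pow p hn]

/-- **(3), common-target form, FAILS at `c_n`, `n ≠ 0`, for EVERY identification** (p436476). [claim: Joshi2023ATS2Local, status: disputed] -/
theorem not_noInsertedIso_of_ne_zero {n : ℤ} (hn : n ≠ 0) {C : Type} [Field C]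
    (I : (confluentDatum p).CommonTarget C (col p n)) : ¬ PeriodRingDatum.NoInsertedIso I :=
  PeriodRingDatum.not_noInsertedIso_of_transport (transport p n hn) I

/-- **(3), middle-row form, FAILS at `c_n`, `n ≠ 0`** (p430819 `not_noCommutingFieldIso_of_transport`). [claim: Joshi2023ATS2Local, status: disputed] -/
theorem not_noCommutingFieldIso_of_ne_zero {n : ℤ} (hn : n ≠ 0) : ¬ (confluentDatum p).NoCommutingFieldIso (col p n) :=
  (confluentDatum p).not_noCommutingFieldIso_of_transport (transport p n hn)

/-- **(4) HOLDS at `c_n`, `n ≠ 0`** (p430819 `logShellStep_of_frobCompatible`). [claim: Joshi2023ATS2Local, status: disputed] -/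
theorem logShellStep_of_ne_zero {n : ℤ} (hn : n ≠ 0) : PeriodRingDatum.LogShellStep (idTarget p (col p n)) :=
  PeriodRingDatum.logShellStep_of_frobCompatible (transport p n hn) _ (frobCompatible p n hn)

/-- **(R-fix) FAILS at `c_n`, `n ≠ 0`, for EVERY identification** with `p ≠ 1` (p436476). [claim: Joshi2023ATS2Local, status: disputed] -/
theorem not_logsCoincide_of_ne_zero {n : ℤ} (hn : n ≠ 0) {C : Type} [Field C]
    (I : (confluentDatum p).CommonTarget C (col p n)) (hpC : ((confluentDatum p).p : C) ≠ 1) :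
    ¬ PeriodRingDatum.LogsCoincide I :=
  PeriodRingDatum.not_logsCoincide_of_transport (transport p n hn) I (hone p n) hpC

/-- **BOTH HORNS OF THE Thm. 10.15.1 (3) FORK IN ONE STRUCTURE** (over `Q̄_2`): ONE period-ring datum with `KummerShift` and a
non-zero Tate module, and two CONSECUTIVE points `y₀`, `y₁ = ϕ(y₀)` such that — at `y₀`: §10.13's transport is EMPTY, (R-fix) holds,
the logarithm hits `1`, `p ≠ 1`, (3) HOLDS in both typed forms and (4) holds; — at `y₁`: §10.13's transport exists with (R-ϕ), the
logarithm hits `1`, (3) FAILS in both typed forms, (4) holds and (R-fix) fails. So p430819's `noInsertedIso_of_logsCoincide` is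
NOT vacuous over the signature, and the two horns are separated by §10.13 at the point and by nothing else the signature records.
A model exhibits satisfiability, nothing more. [folklore] -/
theorem both_horns_one_structure :
    ∃ (D : PeriodRingDatum (PadicAlgCl 2) (PadicAlgCl 2 → PadicAlgCl 2) (PadicAlgCl 2) (PadicAlgCl 2) (fun _ => PadicAlgCl 2) Unit)
      (y₀ y₁ : PadicAlgCl 2) (I₀ : D.CommonTarget (PadicAlgCl 2) y₀) (T₁ : D.FrobeniusTransport y₁)
      (I₁ : D.CommonTarget (PadicAlgCl 2) y₁),
      D.frobY y₀ = y₁ ∧ D.KummerShift ∧ (∃ y' τ, τ ∈ D.T y' ∧ τ ≠ 0) ∧ (D.p : PadicAlgCl 2) ≠ 1 ∧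
        (IsEmpty (D.FrobeniusTransport y₀) ∧ PeriodRingDatum.LogsCoincide I₀ ∧ (∃ b ∈ D.Bphi, D.eta (D.frobY y₀) b = 1) ∧
          PeriodRingDatum.NoInsertedIso I₀ ∧ D.NoCommutingFieldIso y₀ ∧ PeriodRingDatum.LogShellStep I₀) ∧
        (PeriodRingDatum.FrobCompatible T₁ I₁ ∧ (∃ b ∈ D.Bphi, D.eta (D.frobY y₁) b = 1) ∧
          ¬ PeriodRingDatum.NoInsertedIso I₁ ∧ ¬ D.NoCommutingFieldIso y₁ ∧ PeriodRingDatum.LogShellStep I₁ ∧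
          ¬ PeriodRingDatum.LogsCoincide I₁) :=
  haveI : Fact (Nat.Prime 2) := ⟨Nat.prime_two⟩
  ⟨confluentDatum 2, col 2 0, col 2 1, idTarget 2 (col 2 0), transport 2 1 one_ne_zero, idTarget 2 (col 2 1),
    frobY_col_zero 2, kummerShift 2, (let ⟨τ, hτ, hτ0⟩ := tateModule_nontrivial 2; ⟨(2 : PadicAlgCl 2), τ, hτ, hτ0⟩),
    modelP_ne_one 2,
    ⟨no_transport_zero 2, logsCoincide_zero 2, hone 2 0, noInsertedIso_zero 2, noCommutingFieldIso_zero 2, logShellStep_zero 2⟩,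
    ⟨frobCompatible 2 1 one_ne_zero, hone 2 1, not_noInsertedIso_of_ne_zero 2 one_ne_zero _,
      not_noCommutingFieldIso_of_ne_zero 2 one_ne_zero, logShellStep_of_ne_zero 2 one_ne_zero,
      not_logsCoincide_of_ne_zero 2 one_ne_zero _ (modelP_ne_one 2)⟩⟩

end ConfluentModel

end Summit.ABC.IUTFork.Joshi

end
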